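import Summits.CriticalPhenomena.PercolationContinuityZ3.Theses.PercNearOneGluing
import Literature.Probability.Percolation.PercolationProofs
import Literature.Probability.Percolation.ConditionalPositiveAssociationProofs
import Literature.Probability.Percolation.TwoClusterConditionalAssociationProofs

/-! TTRL-lite variant V160 of stmt-CriticalPhenomena-4576 -/

namespace Summit.CriticalPhenomena.PercolationContinuityZ3.Theorems

open MeasureTheory Literature.Probability.LatticeModels Literature.Probability.Percolation
open scoped Classical BigOperators

/-- TTRL-lite variant V160 (`fix_nat:n=3;card_eq:A=2`) of the registered stub `stub_goodStep` of
stmt-CriticalPhenomena-4576: on three vertices with `A.card = 2` and `o ∉ A`, the set `A ∪ {o}`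
exhausts `Fin 3`, so the low neighbour `y ∉ A`, `y ≠ o` demanded by the hypothesis cannot exist
and the inductive step of the good-quadruple (penalised-selection) inequality holds vacuously.
[this project] -/
theorem stub_goodStep_var160 : ∀ (w : Sym2 (Fin 3) → unitInterval) (A : Finset (Fin 3)) (o b : Fin 3), A.card = 2 → b ∈ A → o ∉ A → (∃ y : Fin 3, y ∉ A ∧ y ≠ o ∧ (w s(o, y) : ℝ) ≠ 0) → (∀ w' : Sym2 (Fin 3) → unitInterval, (Finset.univ.filter (fun v : Fin 3 => ∃ u : Fin 3, 0 < (w' s(u, v) : ℝ))).card < (Finset.univ.filter (fun v : Fin 3 => ∃ u : Fin 3, 0 < (w s(u, v) : ℝ))).card → ∀ (A' : Finset (Fin 3)) (o' b' : Fin 3), b' ∈ A' → o' ∉ A' → ∀ (t : ℝ) (sel : Finset (Fin 3) → Fin 3), (∀ W, sel W ∈ A') → (∀ a ∈ A', 1 - t ≤ (prodBernoulli w').real (openConn a b')) → (prodBernoulli w').real ((⋃ a ∈ A', openConn o' a) ∩ (openConn o' b')ᶜ) + ∑ W ∈ (Finset.univ : Finset (Finset (Fin 3))).filter (fun W => o'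 ∈ W ∧ Disjoint W A'), (prodBernoulli w').real {ω : BondConfig (Fin 3) | openCluster ω o' = (W : Set (Fin 3))} * (prodBernoulli w').real (openConnIn ((W : Set (Fin 3))ᶜ) (sel W) b')ᶜ ≤ t) → ∀ (t : ℝ) (sel : Finset (Fin 3) → Fin 3), (∀ W, sel W ∈ A) → (∀ a ∈ A, 1 - t ≤ (prodBernoulli w).real (openConn a b)) → (prodBernoulli w).real ((⋃ a ∈ A, openConn o a) ∩ (openConn o b)ᶜ) + ∑ W ∈ (Finset.univ : Finset (Finset (Fin 3))).filter (fun W => o ∈ W ∧ Disjoint W A), (prodBernoulli w).real {ω : BondConfig (Fin 3) | openCluster ω o = (W : Set (Fin 3))} * (prodBernoulli w).real (openConnIn ((W : Set (Fin 3))ᶜ) (sel W) b)ᶜ ≤ t := by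
  intro w A o b _hA _hbA hoA hy _ih _t _sel _hsel _hrel
  exfalso
  obtain ⟨y, hyA, hyo, -⟩ := hy
  have hoy : o ∉ insert y A := by
    rw [Finset.mem_insert]
    rintro (h | h)
    exacts [hyo h.symm, hoA h]
  have hle : (insert o (insert y A)).card ≤ Fintype.card (Fin 3) := Finset.card_le_univ _
  rw [Fintype.card_fin, Finset.card_insert_of_notMem hoy, Finset.card_insert_of_notMem hyA] at hle
  omega

end Summit.CriticalPhenomena.PercolationContinuityZ3.Theorems
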